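import Summits.Parity.GeneralizedHardyLittlewood.Theorems.ChenParityOracleBLAPHostParityFromBrickSwitched
import Summits.Parity.GeneralizedHardyLittlewood.Theorems.ChenParityOracleBLAPHostParityFromBrickSwitchedTerms
import HarnessLib

/-!
# Route `ChenParityOracleBLAP` — crux S1 = `HostParityFromBrick` (stmt-Parity-20045): the switched half, limit `x → ∞`

Support file for the switched half `K1 → K2 → HP2` of S1.  With `ρ = 1 + (log x)^{-9}` and `A = 40`
the bound of `switched_level_sum_le_at` is `O(x/(log x)^{5/2})`:
* good classes: `(⌊log(x+2)/log ρ⌋+1)³ (1+(1+log x)²) x/(log x)^{40} ≤ 160 x/(log x)^8` (`goodTerm_le`);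
* small classes: `⌊8x^{1−δ}⌋ (1 + log⌊8x^{1−δ}⌋) ≤ 40 x^{1−δ} log x` (`smallTerm_le`);
* boundary classes: `≤ 31 x/((log x)² √(log x))` once `7(log x)^8 ≤ x^{1/6}` (`bdryTerm_le`);
so the twisted level sum of Chen's switched host is `≤ η x/(log x)²` for every `η > 0` and all large
`x` (`switched_eventually`), GIVEN K1 and K2 eventually in `x` (hypotheses `hK1`, `hK2`).

References: Chen Jing-run, Sci. Sinica 16 (1973) [ChenSciSinica1973]; G. Harman, *Prime-Detecting
Sieves* (2007), Ch. 3 [Harman2007].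
-/

namespace Summit.Parity.GeneralizedHardyLittlewood.Theorems

open Finset Real Filter
open Literature.NumberTheory.Sieve.Chen

/-! ### Eventually-in-`x` facts -/

/-- The elementary facts about `x`, `L = log x` used by the switched half, eventually in `x : ℕ`:
`24 ≤ x`, `8 ≤ log log x`, `C ≤ log x`, `480/η ≤ (log x)^6`, `(log x)^3 ≤ (η/120) x^δ`,
`7 (log x)^8 ≤ x^{1/6}`, `(log x)^9 ≤ x`, `6 ≤ x^δ`, `6 ≤ x^{1/3}`. -/
theorem switched_eventually_facts {δ : ℝ} (hδ0 : 0 < δ) {η : ℝ} (hη : 0 < η) (C : ℝ) :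
    ∀ᶠ x : ℕ in atTop, (24 : ℝ) ≤ x ∧ 8 ≤ Real.log (Real.log x) ∧ C ≤ Real.log x ∧
      480 / η ≤ Real.log x ^ 6 ∧ Real.log x ^ 3 ≤ η / 120 * (x : ℝ) ^ δ ∧
      7 * Real.log x ^ 8 ≤ (x : ℝ) ^ (1 / 6 : ℝ) ∧ Real.log x ^ 9 ≤ (x : ℝ) ∧
      6 ≤ (x : ℝ) ^ δ ∧ 6 ≤ (x : ℝ) ^ (1 / 3 : ℝ) := by
  have hlog := Real.tendsto_log_atTop
  have F1 : ∀ᶠ x : ℝ in atTop, (24 : ℝ) ≤ x := eventually_ge_atTop _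
  have F2 : ∀ᶠ x : ℝ in atTop, 8 ≤ Real.log (Real.log x) := (hlog.comp hlog).eventually_ge_atTop _
  have F3 : ∀ᶠ x : ℝ in atTop, C ≤ Real.log x := hlog.eventually_ge_atTop _
  have F4 : ∀ᶠ x : ℝ in atTop, 480 / η ≤ Real.log x ^ 6 :=
    ((tendsto_pow_atTop (by norm_num : (6 : ℕ) ≠ 0)).comp hlog).eventually_ge_atTop _
  have hpow : ∀ (r : ℕ) {s : ℝ}, 0 < s → ∀ {c : ℝ}, 0 < c →
      ∀ᶠ x : ℝ in atTop, Real.log x ^ r ≤ c * x ^ s := by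
    intro r s hs c hc
    have h := (isLittleO_log_rpow_rpow_atTop (r : ℝ) hs).bound hc
    filter_upwards [h, eventually_ge_atTop (1 : ℝ)] with x hx hx1
    have hl : 0 ≤ Real.log x := Real.log_nonneg hx1
    rw [Real.norm_of_nonneg (Real.rpow_nonneg hl _), Real.norm_of_nonneg (Real.rpow_nonneg (by linarith) _),
      Real.rpow_natCast] at hx
    exact hx
  have F5 : ∀ᶠ x : ℝ in atTop, Real.log x ^ 3 ≤ η / 120 * x ^ δ := hpow 3 hδ0 (by positivity)
  have F6 : ∀ᶠ x : ℝ in atTop, 7 * Real.log x ^ 8 ≤ x ^ (1 / 6 : ℝ) := by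
    filter_upwards [hpow 8 (by norm_num : (0 : ℝ) < 1 / 6) (by norm_num : (0 : ℝ) < 1 / 7)] with x hx
    linarith
  have F7 : ∀ᶠ x : ℝ in atTop, Real.log x ^ 9 ≤ x := by
    filter_upwards [hpow 9 (by norm_num : (0 : ℝ) < 1) (by norm_num : (0 : ℝ) < 1),
      eventually_ge_atTop (0 : ℝ)] with x hx hx0
    rw [Real.rpow_one, one_mul] at hx; exact hx
  have F8 : ∀ᶠ x : ℝ in atTop, 6 ≤ x ^ δ := (tendsto_rpow_atTop hδ0).eventually_ge_atTop _
  have F9 : ∀ᶠ x : ℝ in atTop, 6 ≤ x ^ (1 / 3 : ℝ) :=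
    (tendsto_rpow_atTop (by norm_num)).eventually_ge_atTop _
  have E := ((F1.and F2).and ((F3.and F4).and ((F5.and F6).and ((F7.and F8).and F9))))
  have EN := tendsto_natCast_atTop_atTop.eventually E
  filter_upwards [EN] with x hx
  obtain ⟨⟨h1, h2⟩, ⟨h3, h4⟩, ⟨h5, h6⟩, ⟨h7, h8⟩, h9⟩ := hx
  exact ⟨h1, h2, h3, h4, h5, h6, h7, h8, h9⟩

/-! ### The switched half -/

/-- **The switched half of S1, given K1 and K2 eventually.**  If K1 holds for all `x ≥ x₁` and K2
(level `x^{1/2−ε}`) for all `x ≥ x₂`, both on the `δ`-window with saving `A = 40`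
(`0 < δ ≤ 1/3`), then for every `η > 0`,
`∑_{d ≤ x^{1/2−ε}} |∑_{e ∈ B(x), d ∣ e} λ(e)| ≤ η x/(log x)²` for all large `x`
(`switched_level_sum_le_at` with `ρ = 1 + (log x)^{-9}`, then `goodTerm_le`, `smallTerm_le`,
`bdryTerm_le`). -/
theorem switched_eventually {δ : ℝ} (hδ0 : 0 < δ) (hδ1 : δ ≤ 1 / 3) {ε : ℝ} (hε : 0 ≤ ε)
    {x₁ x₂ : ℕ}
    (hK1 : ∀ x : ℕ, x₁ ≤ x → ∀ M N : ℕ, (x : ℝ) ^ (1 / 3 - δ) ≤ M → (M : ℝ) ≤ (x : ℝ) ^ (1 / 2 : ℝ) →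
      (x : ℝ) ^ (1 - δ) ≤ (M : ℝ) * N → (M : ℝ) * N ≤ x → ∀ α β : ℕ → ℝ, (∀ n, |α n| ≤ 1) →
      (∀ n, |β n| ≤ 1) →
      (∀ n, α n ≠ 0 → ∀ p ∈ n.primeFactors, Real.exp (Real.log x / Real.log (Real.log x)) ≤ p) →
      (∀ n, β n ≠ 0 → ∀ p ∈ n.primeFactors, Real.exp (Real.log x / Real.log (Real.log x)) ≤ p) →
      ∀ h : ℤ, (h = 2 ∨ h = -2) →
      |∑ m ∈ Finset.Ioc M (2 * M), ∑ n ∈ Finset.Ioc N (2 * N),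
        α m * β n * (ArithmeticFunction.liouville (Int.toNat ((m : ℤ) * n + h)) : ℝ)| ≤
        (x : ℝ) / Real.log x ^ (40 : ℝ))
    (hK2 : ∀ x : ℕ, x₂ ≤ x → ∀ M N : ℕ, (x : ℝ) ^ (1 / 3 - δ) ≤ M → (M : ℝ) ≤ (x : ℝ) ^ (1 / 2 : ℝ) →
      (x : ℝ) ^ (1 - δ) ≤ (M : ℝ) * N → (M : ℝ) * N ≤ x → ∀ α β : ℕ → ℝ, (∀ n, |α n| ≤ 1) →
      (∀ n, |β n| ≤ 1) →
      (∀ n, α n ≠ 0 → ∀ p ∈ n.primeFactors, Real.exp (Real.log x / Real.log (Real.log x)) ≤ p) →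
      (∀ n, β n ≠ 0 → ∀ p ∈ n.primeFactors, Real.exp (Real.log x / Real.log (Real.log x)) ≤ p) →
      ∀ h : ℤ, (h = 2 ∨ h = -2) →
      (∑ d ∈ (Finset.Icc 1 ⌊(x : ℝ) ^ (1 / 2 - ε)⌋₊).filter (fun d : ℕ => Odd d),
        |(∑ m ∈ Finset.Ioc M (2 * M), ∑ n ∈ (Finset.Ioc N (2 * N)).filter
            (fun n : ℕ => (d : ℤ) ∣ (m : ℤ) * n + h),
            α m * β n * (ArithmeticFunction.liouville (Int.toNat ((m : ℤ) * n + h)) : ℝ)) -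
          (Nat.totient d : ℝ)⁻¹ * ∑ m ∈ Finset.Ioc M (2 * M), ∑ n ∈ Finset.Ioc N (2 * N),
            α m * β n * (ArithmeticFunction.liouville (Int.toNat ((m : ℤ) * n + h)) : ℝ)|) ≤
        (x : ℝ) / Real.log x ^ (40 : ℝ))
    {η : ℝ} (hη : 0 < η) :
    ∃ x₀ : ℕ, ∀ x : ℕ, x₀ ≤ x →
      (∑ d ∈ Finset.Icc 1 ⌊(x : ℝ) ^ (1 / 2 - ε)⌋₊,
        |∑ e ∈ (chenSetB x).filter (fun e => d ∣ e), (ArithmeticFunction.liouville e : ℝ)|) ≤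
      η * (x : ℝ) / Real.log x ^ 2 := by
  have EV := (switched_eventually_facts hδ0 hη (max 2 ((93 / η) ^ 2))).and
    ((eventually_ge_atTop x₁).and (eventually_ge_atTop x₂))
  obtain ⟨x₀, hx₀⟩ := Filter.eventually_atTop.mp EV
  refine ⟨x₀, fun x hx => ?_⟩
  obtain ⟨⟨h24, hll, hC, hL6, hL3, hL8, hL9, hxδ6, hx13⟩, hxx₁, hxx₂⟩ := hx₀ x hx
  -- notation
  set L : ℝ := Real.log x with hLdef
  have hL2 : 2 ≤ L := le_trans (le_max_left _ _) hC
  have hL93 : (93 / η) ^ 2 ≤ L := le_trans (le_max_right _ _) hC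
  have hL1 : 1 ≤ L := by linarith
  have hL0 : 0 < L := by linarith
  have hx24 : 24 ≤ x := by exact_mod_cast h24
  have hx2r : (2 : ℝ) ≤ x := by linarith
  have hx1r : (1 : ℝ) ≤ x := by linarith
  have hx0 : (0 : ℝ) < x := by linarith
  set ρ : ℝ := 1 + (L ^ 9)⁻¹ with hρdef
  have hL9pos : 0 < L ^ 9 := by positivity
  have hu0 : 0 < (L ^ 9)⁻¹ := by positivity
  have hρ1 : 1 < ρ := by rw [hρdef]; linarith
  have hρ65 : ρ ≤ 6 / 5 := by
    have h512 : (512 : ℝ) ≤ L ^ 9 := by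
      calc (512 : ℝ) = 2 ^ 9 := by norm_num
        _ ≤ L ^ 9 := pow_le_pow_left₀ (by norm_num) hL2 9
    have : (L ^ 9)⁻¹ ≤ 1 / 5 := by
      rw [inv_eq_one_div, div_le_div_iff₀ hL9pos (by norm_num)]; linarith
    rw [hρdef]; linarith
  -- `w₀ ∈ (2, z]`
  have hw : 2 < Real.exp (Real.log x / Real.log (Real.log x)) := by
    have hll0 : 0 < Real.log (Real.log x) := by linarith
    have h1 : 1 ≤ Real.log x / Real.log (Real.log x) := by
      rw [le_div_iff₀ hll0, one_mul]
      have := Real.log_le_sub_one_of_pos hL0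
      rw [← hLdef]; linarith
    calc (2 : ℝ) < Real.exp 1 := by linarith [Real.exp_one_gt_d9]
      _ ≤ Real.exp (Real.log x / Real.log (Real.log x)) := Real.exp_le_exp.mpr h1
  have hw0z : Real.exp (Real.log x / Real.log (Real.log x)) ≤ twinZ x := by
    have hll0 : 0 < Real.log (Real.log x) := by linarith
    have h1 : Real.log x / Real.log (Real.log x) ≤ Real.log x / 8 :=
      div_le_div_of_nonneg_left hL0.le (by norm_num) hll
    calc Real.exp (Real.log x / Real.log (Real.log x)) ≤ Real.exp (Real.log x / 8) :=
          Real.exp_le_exp.mpr h1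
      _ = (x : ℝ) ^ (1 / 8 : ℝ) := by
          rw [Real.rpow_def_of_pos hx0]; congr 1; rw [← hLdef]; ring
      _ ≤ twinZ x := Nat.le_ceil _
  -- `x + 2 ≤ ρ³ x`
  have hρx : (x : ℝ) + 2 ≤ ρ ^ 3 * x := by
    have h1 : 1 + 3 * (L ^ 9)⁻¹ ≤ ρ ^ 3 := by
      rw [hρdef]
      have := one_add_mul_le_pow (show (-2 : ℝ) ≤ (L ^ 9)⁻¹ by linarith) 3
      push_cast at this; linarith
    have h2 : 3 * (L ^ 9)⁻¹ * x ≥ 2 := by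
      rw [ge_iff_le, show 3 * (L ^ 9)⁻¹ * (x : ℝ) = 3 * x / L ^ 9 by ring, le_div_iff₀ hL9pos]
      linarith
    nlinarith
  -- `x^{1/3−δ} ≤ x^{1/3}/ρ − 1`
  have hxδ : (x : ℝ) ^ (1 / 3 - δ) ≤ (x : ℝ) ^ (1 / 3 : ℝ) / ρ - 1 := by
    have h1 : (x : ℝ) ^ (1 / 3 - δ) * (x : ℝ) ^ δ = (x : ℝ) ^ (1 / 3 : ℝ) := by
      rw [← Real.rpow_add hx0]; ring_nf
    have h2 : (x : ℝ) ^ (1 / 3 - δ) * 6 ≤ (x : ℝ) ^ (1 / 3 : ℝ) := by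
      rw [← h1]; exact mul_le_mul_of_nonneg_left hxδ6 (by positivity)
    have h3 : (x : ℝ) ^ (1 / 3 : ℝ) / (6 / 5) ≤ (x : ℝ) ^ (1 / 3 : ℝ) / ρ :=
      div_le_div_of_nonneg_left (by positivity) (by linarith) hρ65
    linarith
  -- the bound at `x`
  have hat := switched_level_sum_le_at hx24 hε hw (hK1 x hxx₁) (hK2 x hxx₂) hρ1 hρ65 hρx hw0z hxδ
  refine hat.trans ?_
  -- the three terms
  have hX : ((x + 2 : ℕ) : ℝ) = (x : ℝ) + 2 := by push_cast; ring
  have hT1 := goodTerm_le hLdef hL2 hx2r hρdef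
  have hT2 := smallTerm_le hLdef hL1 hx1r hδ0
  -- `y = ⌈(x+3)^{1/3}⌉ ≤ 3 x^{1/3}`
  have hy1 : (1 : ℝ) ≤ twinY x := by
    have : 1 ≤ twinY x := Nat.one_le_ceil_iff.mpr (by positivity)
    exact_mod_cast this
  have hy3 : (twinY x : ℝ) ≤ 3 * (x : ℝ) ^ (1 / 3 : ℝ) := by
    have h1 : (twinY x : ℝ) < ((x : ℝ) + 3) ^ (1 / 3 : ℝ) + 1 := by
      unfold twinY; exact Nat.ceil_lt_add_one (by positivity)
    have h2 : ((x : ℝ) + 3) ^ (1 / 3 : ℝ) ≤ 2 * (x : ℝ) ^ (1 / 3 : ℝ) := by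
      calc ((x : ℝ) + 3) ^ (1 / 3 : ℝ) ≤ (8 * x) ^ (1 / 3 : ℝ) :=
            Real.rpow_le_rpow (by positivity) (by linarith) (by norm_num)
        _ = (8 : ℝ) ^ (1 / 3 : ℝ) * (x : ℝ) ^ (1 / 3 : ℝ) := Real.mul_rpow (by norm_num) hx0.le
        _ = 2 * (x : ℝ) ^ (1 / 3 : ℝ) := by
            rw [show (8 : ℝ) = 2 ^ (3 : ℝ) by norm_num, ← Real.rpow_mul (by norm_num)]; norm_num
    have h3 : (1 : ℝ) ≤ (x : ℝ) ^ (1 / 3 : ℝ) := by linarith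
    linarith
  have hT3 := bdryTerm_le hLdef hL1 hx2r hy1 hy3 hL8
  have hρsub : ρ - 1 = (L ^ 9)⁻¹ := by rw [hρdef]; ring
  rw [hX, hρsub]
  refine (add_le_add hT1 (add_le_add hT2 hT3)).trans ?_
  -- `160 x/L^8 + 40 x^{1-δ} L + 31 x/(L²√L) ≤ η x / L²`
  have hsq : Real.log (x : ℝ) ^ 2 = L ^ 2 := by rw [hLdef]
  rw [hsq]
  have hL2pos : 0 < L ^ 2 := by positivity
  have hxL : 0 ≤ (x : ℝ) * L ^ 2 := by positivity
  have e1 : 160 * (x : ℝ) / L ^ 8 ≤ η / 3 * x / L ^ 2 := by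
    -- `480 ≤ η L^6`
    rw [div_le_div_iff₀ (by positivity) hL2pos]
    have h480 : 480 ≤ η * L ^ 6 := by rwa [div_le_iff₀' hη] at hL6
    calc 160 * (x : ℝ) * L ^ 2 = 480 / 3 * ((x : ℝ) * L ^ 2) := by ring
      _ ≤ η * L ^ 6 / 3 * ((x : ℝ) * L ^ 2) := by gcongr
      _ = η / 3 * x * L ^ 8 := by ring
  have e2 : 40 * (x : ℝ) ^ (1 - δ) * L ≤ η / 3 * x / L ^ 2 := by
    rw [le_div_iff₀ hL2pos]
    have h1 : (x : ℝ) ^ (1 - δ) * (x : ℝ) ^ δ = x := by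
      rw [← Real.rpow_add hx0]; norm_num
    have h2 : 120 * L ^ 3 ≤ η * (x : ℝ) ^ δ := by linarith
    have h3 : 0 ≤ (x : ℝ) ^ (1 - δ) := by positivity
    calc 40 * (x : ℝ) ^ (1 - δ) * L * L ^ 2 = (x : ℝ) ^ (1 - δ) * (120 * L ^ 3) / 3 := by ring
      _ ≤ (x : ℝ) ^ (1 - δ) * (η * (x : ℝ) ^ δ) / 3 := by gcongr
      _ = η / 3 * x := by rw [show (x : ℝ) ^ (1 - δ) * (η * (x : ℝ) ^ δ) = η * ((x : ℝ) ^ (1 - δ) * (x : ℝ) ^ δ) by ring, h1]; ring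
  have e3 : 31 * (x : ℝ) / (L ^ 2 * Real.sqrt L) ≤ η / 3 * x / L ^ 2 := by
    have hsL : 93 / η ≤ Real.sqrt L := by
      rw [show 93 / η = Real.sqrt ((93 / η) ^ 2) by rw [Real.sqrt_sq (by positivity)]]
      exact Real.sqrt_le_sqrt hL93
    have hsL0 : 0 < Real.sqrt L := Real.sqrt_pos.mpr hL0
    rw [div_le_div_iff₀ (by positivity) hL2pos]
    have h93 : 93 ≤ η * Real.sqrt L := by rwa [div_le_iff₀' hη] at hsL
    calc 31 * (x : ℝ) * L ^ 2 = 93 / 3 * ((x : ℝ) * L ^ 2) := by ring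
      _ ≤ η * Real.sqrt L / 3 * ((x : ℝ) * L ^ 2) := by gcongr
      _ = η / 3 * x * (L ^ 2 * Real.sqrt L) := by ring
  calc 160 * (x : ℝ) / L ^ 8 + (40 * (x : ℝ) ^ (1 - δ) * L + 31 * (x : ℝ) / (L ^ 2 * Real.sqrt L))
      ≤ η / 3 * x / L ^ 2 + (η / 3 * x / L ^ 2 + η / 3 * x / L ^ 2) :=
        add_le_add e1 (add_le_add e2 e3)
    _ = η * (x : ℝ) / L ^ 2 := by ring

end Summit.Parity.GeneralizedHardyLittlewood.Theorems
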